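import Mathlib
import Summits.ResolutionOfSingularities.ResolutionOfSingularities.Theorems.SyzygyFlatteningDefs
import Summits.ResolutionOfSingularities.ResolutionOfSingularities.Theorems.SyzygyFlatteningHigherRankTerminationTowerStageBasic
import Summits.ResolutionOfSingularities.ResolutionOfSingularities.Theorems.SyzygyFlatteningHigherRankTerminationLocAt
import Summits.ResolutionOfSingularities.ResolutionOfSingularities.Theorems.SyzygyFlatteningHigherRankTerminationExistsMinimalDatum
import Literature.AlgebraicGeometry.Resolution.ModuleBlowup
import HarnessLib

/-!
# A valuation ring dominating every stage of the tower has the same tower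

Crux `SyzygyFlattening.HigherRankTermination` (stmt-ResolutionOfSingularities-17045), line
`birth`, registered glue stub `stub_tower_eq_of_dominates` (the v11 CRITERION of the lead).

Let `k ⊆ O` be a valuation ring of `K`, `A ⊆ O` an affine model, and `O'` a second valuation
ring of `K` which contains every stage `tower O A m` of the syzygy-flattening tower along `O`
(`Theorems/SyzygyFlatteningDefs.lean`) and has on every stage the same non-units as `O`
(`O'.valuation y < 1 ↔ O.valuation y < 1` for `y` in a stage). Then the tower along `O'` from
`A` IS the tower along `O`: `tower O' A m = tower O A m` for every `m`.

Proof, by induction on `m`, from two transfer lemmas.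

* `locAt_eq_of_valuation_lt_one_iff`: if `O` and `O'` have the same non-units on `S` then
  `locAt O' S = locAt O S` — the admissible denominators `s ∈ S` (`s⁻¹ ∈ O`, resp. `s⁻¹ ∈ O'`)
  coincide, because for `s ≠ 0`, `s⁻¹ ∈ O ↔ ¬ O.valuation s < 1`
  (`inv_mem_iff_not_valuation_lt_one`). This gives stage `0` (`S = A ≤ tower O A 0`) and, once
  the charts agree, the step (`S = nrm (chart O B) ≤ tower O A (m + 1)`).
* `chartSet_eq_of_valuation_lt_one_iff`: for a stage `B ⊆ O` whose next stage
  `locAt O (nrm (chart O B))` lies in `O'` with the same non-units, `chartSet O' B = chartSet O B`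
  (same resolutions, embeddings and tuples; only the minimality clause refers to the valuation
  ring). An `O`-minimal tuple `x` is `O'`-minimal since every ratio `det (ι g') / det (ι x)` is
  itself an adjoined ratio, so lies in the next stage `⊆ O'`. Conversely, given an `O'`-minimal
  `x'`, the SAME embedding `ι` (injective with torsion cokernel, so a framing,
  `IsFraming.of_injective`; the syzygy module is finite as the image of a finite free module)
  has an `O`-minimal tuple `x` (`IsFraming.exists_det_div_mem`, `ModuleBlowup.lean`); the ratio
  `s = det (ι x') / det (ι x)` lies in the next stage and `s⁻¹ ∈ O'`, hence `s⁻¹ ∈ O`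
  (`inv_mem_iff_inv_mem_of_valuation_lt_one_iff`), and
  `det (ι g') / det (ι x') = (det (ι g') / det (ι x)) * s⁻¹ ∈ O`: `x'` is `O`-minimal
  (`minimal_of_minimal_of_valuation_lt_one_iff`).

All of this is folklore (the local ring of a variety along a valuation depends only on the
centre; Zariski–Samuel VI §§3, 10; Novacoski–Spivakovsky 2014, Def. 2.8 and 2.11 for the
objects).
-/

noncomputable section

-- single-problem summit: the doubled namespace component `ResolutionOfSingularities` is forced
set_option linter.dupNamespace false

namespace Summit.ResolutionOfSingularities.ResolutionOfSingularities.Theorems.SyzygyFlattening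

open Literature.AlgebraicGeometry.Resolution

variable {k K : Type} [Field k] [Field K] [Algebra k K]

/-! ## Inverses and non-units of a valuation ring -/

/-- For `s ≠ 0`: `s⁻¹ ∈ O` iff `s` is not an `O`-non-unit, `¬ O.valuation s < 1`
(`O.valuation s⁻¹ ≤ 1 ↔ 1 ≤ O.valuation s`). [folklore] -/
theorem inv_mem_iff_not_valuation_lt_one (O : ValuationSubring K) {s : K} (hs0 : s ≠ 0) :
    s⁻¹ ∈ O ↔ ¬ O.valuation s < 1 := by
  rw [← O.valuation_le_one_iff, ← Valuation.one_le_val_iff _ hs0, not_lt]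

/-- If two valuation rings `O`, `O'` of `K` agree on whether `s` is a non-unit, they agree on
whether `s⁻¹` is an element (`s = 0`: `0⁻¹ = 0` lies in both). [folklore] -/
theorem inv_mem_iff_inv_mem_of_valuation_lt_one_iff (O O' : ValuationSubring K) {s : K}
    (h : O'.valuation s < 1 ↔ O.valuation s < 1) : s⁻¹ ∈ O' ↔ s⁻¹ ∈ O := by
  by_cases hs0 : s = 0
  · rw [hs0, inv_zero]
    exact ⟨fun _ => O.zero_mem, fun _ => O'.zero_mem⟩
  · rw [inv_mem_iff_not_valuation_lt_one O' hs0, inv_mem_iff_not_valuation_lt_one O hs0, h]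

/-! ## Localisation at the centre depends only on the non-units -/

/-- **`locAt` depends only on the non-units.** If `O` and `O'` have the same non-units on the
`k`-subalgebra `S` then `locAt O' S = locAt O S`: the generating fractions `a * s⁻¹`
(`a, s ∈ S`, `s⁻¹` in the valuation ring) are the same. [folklore] -/
theorem locAt_eq_of_valuation_lt_one_iff (O O' : ValuationSubring K) (S : Subalgebra k K)
    (h : ∀ s ∈ S, O'.valuation s < 1 ↔ O.valuation s < 1) : locAt O' S = locAt O S := by
  have hgen : {y : K | ∃ a ∈ S, ∃ s ∈ S, s⁻¹ ∈ O' ∧ y = a * s⁻¹} =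
      {y : K | ∃ a ∈ S, ∃ s ∈ S, s⁻¹ ∈ O ∧ y = a * s⁻¹} := by
    ext y
    constructor
    · rintro ⟨a, ha, s, hs, hsO, rfl⟩
      exact ⟨a, ha, s, hs, (inv_mem_iff_inv_mem_of_valuation_lt_one_iff O O' (h s hs)).mp hsO,
        rfl⟩
    · rintro ⟨a, ha, s, hs, hsO, rfl⟩
      exact ⟨a, ha, s, hs, (inv_mem_iff_inv_mem_of_valuation_lt_one_iff O O' (h s hs)).mpr hsO,
        rfl⟩
  rw [locAt_def, locAt_def, hgen]

/-! ## Minimal minors depend only on the non-units of the next stage -/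

/-- The route's determinant `det ((ι (g i) j : K))ᵢⱼ` of a tuple `g` is the image in `K` of the
determinant of the frame matrix `frameMatrix ι g` (`ModuleBlowup.lean`). [folklore] -/
theorem det_coe_eq_algebraMap_frameMatrix_det (B : Subalgebra k K) {M : Type*} [AddCommGroup M]
    [Module ↥B M] {r : ℕ} (ι : M →ₗ[↥B] (Fin r → ↥B)) (g : Fin r → M) :
    Matrix.det (Matrix.of fun i j => ((ι (g i) j : ↥B) : K)) =
      algebraMap ↥B K (frameMatrix ι g).det :=
  det_of_algebraMap_frame_eq ι g

/-- **Transfer of minimality.** Let `D : X → K` (the determinants of the tuples of one datum),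
`x` with `D x ≠ 0` `O`-minimal (`D g * (D x)⁻¹ ∈ O` for all `g`) and such that all the ratios
`D g * (D x)⁻¹` lie in a set `T` on which `O` and `O'` have the same non-units. Then every
`O'`-minimal `x'` is `O`-minimal: with `s = D x' * (D x)⁻¹ ∈ T`, `s⁻¹ = D x * (D x')⁻¹ ∈ O'`,
hence `s⁻¹ ∈ O`, and `D g * (D x')⁻¹ = (D g * (D x)⁻¹) * s⁻¹`. [folklore] -/
theorem minimal_of_minimal_of_valuation_lt_one_iff {X : Type*} (O O' : ValuationSubring K)
    (D : X → K) (T : Set K) (hT : ∀ y ∈ T, O'.valuation y < 1 ↔ O.valuation y < 1) {x x' : X}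
    (hx0 : D x ≠ 0) (hmin : ∀ g : X, D g * (D x)⁻¹ ∈ O) (hxT : ∀ g : X, D g * (D x)⁻¹ ∈ T)
    (hmin' : ∀ g : X, D g * (D x')⁻¹ ∈ O') : ∀ g : X, D g * (D x')⁻¹ ∈ O := by
  -- `s⁻¹ = D x * (D x')⁻¹` lies in `O'` by the `O'`-minimality of `x'`, hence in `O`
  have hsinv : (D x' * (D x)⁻¹)⁻¹ = D x * (D x')⁻¹ := by
    rw [mul_inv_rev, inv_inv]
  have hsO' : (D x' * (D x)⁻¹)⁻¹ ∈ O' := by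
    rw [hsinv]
    exact hmin' x
  have hsO : D x * (D x')⁻¹ ∈ O := by
    rw [← hsinv]
    exact (inv_mem_iff_inv_mem_of_valuation_lt_one_iff O O' (hT _ (hxT x'))).mp hsO'
  intro g
  have e : D g * (D x')⁻¹ = D g * (D x)⁻¹ * (D x * (D x')⁻¹) := by
    rw [mul_assoc, ← mul_assoc (D x)⁻¹, inv_mul_cancel₀ hx0, one_mul]
  rw [e]
  exact mul_mem (hmin g) hsO

/-- The adjoined ratios of a stage lie in the next stage:
`chartSet O B ⊆ chart O B ≤ nrm (chart O B) ≤ locAt O (nrm (chart O B))`. [folklore] -/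
theorem chartSet_subset_step (O : ValuationSubring K) (B : Subalgebra k K) :
    chartSet O B ⊆ locAt O (nrm (chart O B)) := fun _ hy =>
  self_le_locAt O _ (self_le_nrm _ (Algebra.subset_adjoin (Or.inr hy)))

/-- **The adjoined ratios depend only on the non-units of the next stage.** For a stage `B ⊆ O`
whose next stage `locAt O (nrm (chart O B))` lies in `O'` with the same non-units as `O`:
`chartSet O' B = chartSet O B`. `⊇`: an `O`-minimal tuple is `O'`-minimal, its ratios being
adjoined ratios, in the next stage `⊆ O'`. `⊆`: for an `O'`-minimal `x'` the same embedding `ι`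
(a framing, `IsFraming.of_injective`) has an `O`-minimal tuple `x`
(`IsFraming.exists_det_div_mem`), and `x'` is then `O`-minimal by
`minimal_of_minimal_of_valuation_lt_one_iff`. [folklore] -/
theorem chartSet_eq_of_valuation_lt_one_iff (O O' : ValuationSubring K) (B : Subalgebra k K)
    (hB : B.toSubring ≤ O.toSubring)
    (hnext : (locAt O (nrm (chart O B))).toSubring ≤ O'.toSubring)
    (hunits : ∀ y ∈ locAt O (nrm (chart O B)), O'.valuation y < 1 ↔ O.valuation y < 1) :
    chartSet O' B = chartSet O B := by
  ext y
  constructor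
  · rintro ⟨b, d, ε, r, ι, hε, h0, hs, hι, htors, g, x', hx0', hmin', rfl⟩
    -- an `O`-minimal tuple `x` for the same embedding `ι`
    have hinj : Function.Injective (algebraMap ↥B K) := fun a a' h => Subtype.ext h
    have hBO : ∀ a : ↥B, algebraMap ↥B K a ∈ O := fun a => hB a.2
    have hφ : IsFraming ι := IsFraming.of_injective hι htors
    obtain ⟨x, hx0, hmin⟩ := hφ.exists_det_div_mem O hinj hBO
    have hx0D : Matrix.det (Matrix.of fun i j => ((ι (x i) j : ↥B) : K)) ≠ 0 := by
      rw [det_coe_eq_algebraMap_frameMatrix_det]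
      exact hx0
    have hminD : ∀ g' : Fin r → ↥(LinearMap.range (d (syzygyIndex k K - 1))),
        Matrix.det (Matrix.of fun i j => ((ι (g' i) j : ↥B) : K)) *
          (Matrix.det (Matrix.of fun i j => ((ι (x i) j : ↥B) : K)))⁻¹ ∈ O := fun g' => by
      rw [det_coe_eq_algebraMap_frameMatrix_det, det_coe_eq_algebraMap_frameMatrix_det,
        ← div_eq_mul_inv]
      exact hmin g'
    have hxT : ∀ g' : Fin r → ↥(LinearMap.range (d (syzygyIndex k K - 1))),
        Matrix.det (Matrix.of fun i j => ((ι (g' i) j : ↥B) : K)) *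
          (Matrix.det (Matrix.of fun i j => ((ι (x i) j : ↥B) : K)))⁻¹ ∈
            ((locAt O (nrm (chart O B)) : Subalgebra k K) : Set K) := fun g' =>
      chartSet_subset_step O B ⟨b, d, ε, r, ι, hε, h0, hs, hι, htors, g', x, hx0D, hminD, rfl⟩
    have hminO := minimal_of_minimal_of_valuation_lt_one_iff O O'
      (fun g' : Fin r → ↥(LinearMap.range (d (syzygyIndex k K - 1))) =>
        Matrix.det (Matrix.of fun i j => ((ι (g' i) j : ↥B) : K)))
      ((locAt O (nrm (chart O B)) : Subalgebra k K) : Set K) (fun y hy => hunits y hy)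
      (x := x) (x' := x') hx0D hminD hxT hmin'
    exact ⟨b, d, ε, r, ι, hε, h0, hs, hι, htors, g, x', hx0', hminO, rfl⟩
  · rintro ⟨b, d, ε, r, ι, hε, h0, hs, hι, htors, g, x, hx0, hmin, rfl⟩
    refine ⟨b, d, ε, r, ι, hε, h0, hs, hι, htors, g, x, hx0, fun g' => ?_, rfl⟩
    exact hnext (Subalgebra.mem_toSubring.mpr
      (chartSet_subset_step O B ⟨b, d, ε, r, ι, hε, h0, hs, hι, htors, g', x, hx0, hmin, rfl⟩))

/-- Hence the charts agree: `chart O' B = chart O B`. [folklore] -/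
theorem chart_eq_of_valuation_lt_one_iff (O O' : ValuationSubring K) (B : Subalgebra k K)
    (hB : B.toSubring ≤ O.toSubring)
    (hnext : (locAt O (nrm (chart O B))).toSubring ≤ O'.toSubring)
    (hunits : ∀ y ∈ locAt O (nrm (chart O B)), O'.valuation y < 1 ↔ O.valuation y < 1) :
    chart O' B = chart O B := by
  rw [chart_def, chart_def, chartSet_eq_of_valuation_lt_one_iff O O' B hB hnext hunits]

/-- **One step depends only on the non-units of the next stage**: for a stage `B ⊆ O` whose
next stage lies in `O'` with the same non-units, `step O' B = step O B`. [folklore] -/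
theorem step_eq_of_valuation_lt_one_iff (O O' : ValuationSubring K) (B : Subalgebra k K)
    (hB : B.toSubring ≤ O.toSubring)
    (hnext : (locAt O (nrm (chart O B))).toSubring ≤ O'.toSubring)
    (hunits : ∀ y ∈ locAt O (nrm (chart O B)), O'.valuation y < 1 ↔ O.valuation y < 1) :
    locAt O' (nrm (chart O' B)) = locAt O (nrm (chart O B)) := by
  rw [chart_eq_of_valuation_lt_one_iff O O' B hB hnext hunits]
  exact locAt_eq_of_valuation_lt_one_iff O O' _ fun s hs => hunits s (self_le_locAt O _ hs)

/-! ## The registered stub -/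

/-- **STUB `stub_tower_eq_of_dominates` (glue, v11).** If a valuation ring `O'` contains every
stage of the `O`-tower and induces on each stage the same centre as `O` (an element of a stage
is a non-unit of `O'` iff it is a non-unit of `O`), then the tower along `O'` from `A` IS the
tower along `O`: stage by stage the admissible denominators of `locAt` coincide
(`locAt_eq_of_valuation_lt_one_iff`), an `O`-minimal minor is `O'`-minimal because its Plücker
ratios lie in the next stage `⊆ O'`, and conversely the quotient of an `O'`-minimal and an
`O`-minimal minor of the same embedding is a unit of both, so `chartSet`, `chart`, `nrm` and
`locAt` coincide (`step_eq_of_valuation_lt_one_iff`). (The hypotheses `A.FG` and `Frac A = K`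
are not used: the syzygy module is finite as the image of a finite free module.) [folklore] -/
theorem stub_tower_eq_of_dominates : ∀ (k K : Type) [Field k] [Field K] [Algebra k K]
    (O O' : ValuationSubring K) (A : Subalgebra k K), (∀ c : k, algebraMap k K c ∈ O) → A.FG →
      IsFractionRing ↥A K → A.toSubring ≤ O.toSubring →
      (∀ m : ℕ, (tower O A m).toSubring ≤ O'.toSubring ∧
        ∀ y ∈ tower O A m, O'.valuation y < 1 ↔ O.valuation y < 1) →
      ∀ m : ℕ, tower O' A m = tower O A m := by
  intro k K _ _ _ O O' A hk _hFG _hFrac hAO hdom m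
  induction m with
  | zero =>
    rw [tower_zero, tower_zero]
    exact locAt_eq_of_valuation_lt_one_iff O O' A fun s hs =>
      (hdom 0).2 s (self_le_tower O A 0 hs)
  | succ m ih =>
    obtain ⟨hnext, hunits⟩ := hdom (m + 1)
    rw [tower_succ] at hnext hunits
    rw [tower_succ, tower_succ, ih]
    exact step_eq_of_valuation_lt_one_iff O O' (tower O A m) (tower_toSubring_le O hk hAO m)
      hnext hunits

end Summit.ResolutionOfSingularities.ResolutionOfSingularities.Theorems.SyzygyFlattening

end
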